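import Summits.ABC.IUTFork.Joshi.ThetaJoshiAdelic
import Summits.ABC.IUTFork.Joshi.BundlingRingsRegroup

/-!
# [J-III] Thm. 7.5.4.2, global clause «`Θ̃^{B_{L′}}_{Joshi} = ∏_p Θ̃_{Joshi,p}`» — DERIVED for the typed adelic locus of Def. 6.10.2

Proof-only companion (0 defs, nothing asserted) of `Joshi/BundlingRings.lean` (p429549, abc-iut-E-t13: `PrimeBundlingDatum.locusBundled`
(7.5.3.1), `PrimeBundlingFamily.adelicLocusBundled`, whose docstring left «the EQUALITY with E-t11's adelic locus (J3 Def. 6.10.2) is what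
Thm. 7.5.4.2 asserts — merge-debt, not typed here»), of `Joshi/BundlingRingsRegroup.lean` (p431709: the regrouping (7.5.1.6) `regroup`) and
of abc-iut-E-t11's `Joshi/ThetaJoshiLocusBE.lean` / `Joshi/ThetaJoshiAdelic.lean` (Def. 6.6.1.1 `AdelicLiftDatum.thetaLocusBE`, Def. 6.10.2
`AdelicLiftDatum.thetaLocusBL`, over abc-iut-E-t10's `CollationDatum` of `Joshi/ThetaJoshiConstruction.lean`). Block E of the abc-iut cell
(rung LADDER-ABC:A2.E; seat abc-iut-E-t13, registry row J3:Thm7.5.4.2 — AUTHORS-FIRST derivable row). SOURCE: K. Joshi, *Construction of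
Arithmetic Teichmüller Spaces III*, arXiv:2401.13508v4 (`Joshi2024ATS3`; UNREFEREED, disputed in print): §6.2 p. 43 l. 57–68 «`Θ̃^?_Joshi =
∏_p Θ̃^?_{Joshi,p}`»; Def. 6.10.2 (6.10.3) p. 52 l. 56–70 «`Θ̃^{B_{L′}}_Joshi = {(Ξ_{z,w})_{w ∈ V_{L′}} : z ∈ Σ̃_{L′}}`»; Thm. 7.5.4.2 p. 60
l. 26–51 «one has proved the following theorem … by taking the product over all primes `p`, one obtains the adelic theta-values locus:
(7.5.4.4) `Θ̃^{B_{L′}}_{Joshi} = ∏_p Θ̃_{Joshi,p} ⊂ ∏_p B̆_p^{ℓ⋇} = B_{L′}^{ℓ⋇}`».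

THE POINT. As typed by E-t11 (faithfully to (6.10.3)), the adelic locus is NOT a product by definition: it is the union over the
Ansatz points `z ∈ Σ̃_{L′}` of the products `∏_w {lifts at w from z}` — ONE common `z` serving every place —, while the local loci
`Θ̃^{B_{E′_w}}_Joshi = ⋃_z {lifts at w from z}` let `z` vary with `w`. The product decomposition (7.5.4.4) therefore has content: it
holds because Mochizuki's adelic Ansatz `Σ̃_{L′}` (Def. 4.2.2 (4.2.3), E-t10's `CollationDatum.adelicAnsatz`) is cut out PLACE BY PLACE
(`z_w ∈ Σ̃_{ℂ_p^♭,L′_w}` at `w ∈ V^{odd,ss}`, `z_w` diagonal elsewhere) and the lifts at `w` depend on `z` only through its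
`w`-component `z_w` — so Ansatz points chosen independently at each place can be MIXED into one Ansatz point
(`CollationDatum.mix_mem_adelicAnsatz`). CONTENT (all PROVED, unconditional unless said):
* `AdelicLiftDatum.liftsAt_congr` — `Ξ_{z,w}` depends on `z` only through `z_w`;
* `AdelicLiftDatum.thetaLocusBL_eq_adelicLocus` — **`Θ̃^{B_{L′}}_Joshi = ∏_{w ∈ V_{L′}} Θ̃^{B_{L′_w}}_Joshi`** (E-t10's `adelicLocus` =
  `Set.univ.pi`), no hypothesis;
* `AdelicLiftDatum.regroup_image_thetaLocusBL` — (7.5.4.4) literally: regrouped by the rational prime `p_w` below `w` ((7.5.1.6),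
  E-t13's `regroup`), `Θ̃^{B_{L′}}_Joshi` is `∏_p ∏_{w | p} Θ̃^{B_{L′_w}}_Joshi ⊂ ∏_p B̆_p^{ℓ⋇}`;
* `AdelicLiftDatum.bundled_eq_image_thetaLocusBL` — (7.5.3.1): for any finite set `S` of places (print: `S = V^{odd,ss}_p`), the
  bundled set `{z : z_w ∈ Θ̃^{B_{E′_w}}_Joshi ∀ w ∈ S}` (the shape of E-t13's `PrimeBundlingDatum.locusBundled`) is the image of
  `Θ̃^{B_{L′}}_Joshi` under restriction-and-transposition, granted Teichmüller lifts at every place and `Σ̃_{L′} ≠ ∅` (so that the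
  discarded factors are nonempty; E-t11's `localComponent_eq` is the case `S = {w}`).
What remains of the T-11 ↔ T-13 merge-debt is carrier bookkeeping only (instantiating `PrimeBundlingFamily.loc` from E-t11/E-t12's
data), not a claim of print. No side taken on [IUTchIII] Cor. 3.12, on Joshi's claims or on Mochizuki's reports; typed ≠ proved ≠
endorsed; nothing of the cell's frozen interface is imported. Standard axioms; sorry-free; no instance, notation or definition declared.
-/

noncomputable section

open Set

namespace Summit.ABC.IUTFork.Joshi.ATS3

/-! ## 1. The adelic Ansatz is cut out place by place -/

namespace CollationDatum

variable (A : CollationDatum)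

/-- **Mixing Ansatz points** (Def. 4.2.2 (4.2.3), p. 31 l. 51–67, is a conjunction of conditions on the single `w`-components `z_w`):
if `ζ^{(w)} ∈ Σ̃_{L′}` for every place `w`, the tuple whose `w`-component is `ζ^{(w)}_w` lies in `Σ̃_{L′}`. PROVED from E-t10's
definition `CollationDatum.adelicAnsatz`. [folklore] -/
theorem mix_mem_adelicAnsatz (ζ : A.V → (Fin A.lstar → A.Arith)) (hζ : ∀ w, ζ w ∈ A.adelicAnsatz) :
    (fun j w => ζ w j w) ∈ A.adelicAnsatz :=
  ⟨fun w hw => (hζ w).1 w hw, fun w hw i j => (hζ w).2 w hw i j⟩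

/-- The `w`-component of the mixed tuple is the `w`-component of `ζ^{(w)}`. [folklore] -/
theorem wComponent_mix (ζ : A.V → (Fin A.lstar → A.Arith)) (w : A.V) :
    A.wComponent (fun j w => ζ w j w) w = A.wComponent (ζ w) w :=
  rfl

end CollationDatum

/-! ## 2. The product decomposition of `Θ̃^{B_{L′}}_Joshi` -/

namespace AdelicLiftDatum

variable {A : CollationDatum} {OE B : A.V → Type} [∀ w, CommRing (OE w)] [∀ w, CommRing (B w)] [∀ w, Algebra (OE w) (B w)]
  (𝔇 : AdelicLiftDatum A OE B)

/-- **`Ξ_{z,w}` depends on `z` only through `z_w`** (p. 48 l. 1–13: the lifts at `w` are built from the theta values of the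
`w`-component; (6.5.1) off `V^{odd,ss}`). PROVED. [folklore] -/
theorem liftsAt_congr {z z' : Fin A.lstar → A.Arith} {w : A.V} (h : A.wComponent z w = A.wComponent z' w) :
    𝔇.liftsAt w z = 𝔇.liftsAt w z' := by
  by_cases hw : w ∈ A.Voddss
  · rw [𝔇.liftsAt_of_mem hw, 𝔇.liftsAt_of_mem hw, h]
  · rw [𝔇.liftsAt_of_not_mem hw, 𝔇.liftsAt_of_not_mem hw]

/-- `Θ̃^{B_{L′}}_Joshi ⊂ ∏_w Θ̃^{B_{L′_w}}_Joshi` (each coordinate of `(Ξ_{z,w})_w` is a lift at `w` from the common `z`). [folklore] -/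
theorem thetaLocusBL_subset_adelicLocus : 𝔇.thetaLocusBL ⊆ adelicLocus 𝔇.thetaLocusBE := fun Ξ hΞ => by
  obtain ⟨z, hz, h⟩ := (𝔇.mem_thetaLocusBL_iff Ξ).1 hΞ
  exact (mem_adelicLocus_iff _ _).2 fun w => 𝔇.liftsAt_subset_thetaLocusBE w hz (h w)

/-- `∏_w Θ̃^{B_{L′_w}}_Joshi ⊂ Θ̃^{B_{L′}}_Joshi`: place-dependent Ansatz points are mixed into one (`mix_mem_adelicAnsatz`,
`liftsAt_congr`). [folklore] -/
theorem adelicLocus_subset_thetaLocusBL : adelicLocus 𝔇.thetaLocusBE ⊆ 𝔇.thetaLocusBL := fun Ξ hΞ => by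
  have h : ∀ w, ∃ z, ∃ _ : z ∈ A.adelicAnsatz, Ξ w ∈ 𝔇.liftsAt w z :=
    fun w => mem_iUnion₂.1 ((mem_adelicLocus_iff _ _).1 hΞ w)
  choose ζ hζ hΞζ using h
  refine (𝔇.mem_thetaLocusBL_iff Ξ).2 ⟨fun j w => ζ w j w, A.mix_mem_adelicAnsatz ζ hζ, fun w => ?_⟩
  rw [𝔇.liftsAt_congr (A.wComponent_mix ζ w)]
  exact hΞζ w

/-- **[J-III] Thm. 7.5.4.2 (7.5.4.4) / §6.2 — THE ADELIC THETA-VALUES LOCUS IS THE PRODUCT OF ITS LOCAL LOCI**: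
`Θ̃^{B_{L′}}_Joshi = ∏_{w ∈ V_{L′}} Θ̃^{B_{L′_w}}_Joshi` for E-t11's typed Def. 6.10.2 (`thetaLocusBL`) and Def. 6.6.1.1 (`thetaLocusBE`),
with E-t10's product assembly `adelicLocus`. PROVED, no hypothesis (the contentful inclusion `⊇` is the place-by-place nature of
Mochizuki's adelic Ansatz). Discharges the «merge-debt» equality left open in `PrimeBundlingFamily.adelicLocusBundled`'s docstring.
[claim: Joshi2024ATS3, status: disputed] -/
theorem thetaLocusBL_eq_adelicLocus : 𝔇.thetaLocusBL = adelicLocus 𝔇.thetaLocusBE :=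
  Subset.antisymm 𝔇.thetaLocusBL_subset_adelicLocus 𝔇.adelicLocus_subset_thetaLocusBL

/-- Membership form: `Ξ ∈ Θ̃^{B_{L′}}_Joshi ↔ Ξ_w ∈ Θ̃^{B_{L′_w}}_Joshi` for every `w`. [folklore] -/
theorem mem_thetaLocusBL_iff_forall (Ξ : 𝔇.Tuple) : Ξ ∈ 𝔇.thetaLocusBL ↔ ∀ w, Ξ w ∈ 𝔇.thetaLocusBE w := by
  rw [thetaLocusBL_eq_adelicLocus, mem_adelicLocus_iff]

/-! ## 3. Regrouped by rational primes: (7.5.4.4) `Θ̃^{B_{L′}}_Joshi = ∏_p Θ̃_{Joshi,p} ⊂ ∏_p B̆_p^{ℓ⋇}` -/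

/-- **(7.5.4.4) literally** (p. 60 l. 41–51): under the regrouping (7.5.1.6) `B_{L′}^{ℓ⋇} = ∏_p B̆_p^{ℓ⋇}` by the rational prime `p_w`
below `w` (E-t13's `regroup`, p431709, applied to the tuple rings `B_{L′_w}^{ℓ⋇}`), the adelic locus becomes the product over `p` of
the bundled loci `Θ̃_{Joshi,p} = ∏_{w | p} Θ̃^{B_{L′_w}}_Joshi` ((7.5.3.1) with the trivial factors (6.5.1) at `w ∉ V^{odd,ss}` kept).
PROVED for any index map `below`. [claim: Joshi2024ATS3, status: disputed] -/
theorem regroup_image_thetaLocusBL {P : Type} (below : A.V → P) :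
    ⇑(regroup below fun w => Fin A.lstar → B w) '' 𝔇.thetaLocusBL =
      Set.univ.pi fun p => Set.univ.pi fun x : fibre below p => 𝔇.thetaLocusBE x.1 := by
  ext g
  constructor
  · rintro ⟨Ξ, hΞ, rfl⟩
    exact fun p _ x _ => (𝔇.mem_thetaLocusBL_iff_forall Ξ).1 hΞ x.1
  · intro hg
    refine ⟨(regroup below fun w => Fin A.lstar → B w).symm g, (𝔇.mem_thetaLocusBL_iff_forall _).2 fun w => ?_,
      (regroup below fun w => Fin A.lstar → B w).apply_symm_apply g⟩
    rw [regroup_symm_apply]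
    exact hg (below w) (mem_univ _) ⟨w, rfl⟩ (mem_univ _)

/-! ## 4. (7.5.3.1): the bundled locus over a set of places as an image of the adelic locus -/

/-- **(7.5.3.1) as an image**: for any set of places `S` (print: `S = V^{odd,ss}_p`), the bundled set of `ℓ⋇`-tuples of
`⊕_{w ∈ S} B_{E′_w}` whose `w`-component lies in `Θ̃^{B_{E′_w}}_Joshi` for every `w ∈ S` — the shape of E-t13's
`PrimeBundlingDatum.locusBundled` — is the image of `Θ̃^{B_{L′}}_Joshi` under «restrict to `S` and transpose», granted Teichmüller lifts
at every place and `Σ̃_{L′} ≠ ∅` (E-t11's hypotheses of `thetaLocusBE_nonempty`, needed to refill the discarded coordinates; for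
`S = {w}` this is E-t11's `localComponent_eq`). PROVED. [claim: Joshi2024ATS3, status: disputed] -/
theorem bundled_eq_image_thetaLocusBL (hT : ∀ w, (𝔇.lift w).TeichLiftExists) (hne : A.adelicAnsatz.Nonempty) (S : Set A.V) :
    {z : Fin A.lstar → (w : S) → B w.1 | ∀ w : S, (fun j => z j w) ∈ 𝔇.thetaLocusBE w.1} =
      (fun (Ξ : 𝔇.Tuple) (j : Fin A.lstar) (w : S) => Ξ w.1 j) '' 𝔇.thetaLocusBL := by
  classical
  refine Subset.antisymm (fun z hz => ?_) ?_
  · choose Ξ₀ hΞ₀ using fun w => 𝔇.thetaLocusBE_nonempty hT hne w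
    refine ⟨fun w => if h : w ∈ S then (fun j => z j ⟨w, h⟩) else Ξ₀ w, (𝔇.mem_thetaLocusBL_iff_forall _).2 fun w => ?_, ?_⟩
    · by_cases h : w ∈ S
      · simp only [dif_pos h]; exact hz ⟨w, h⟩
      · simp only [dif_neg h]; exact hΞ₀ w
    · funext j w
      simp only [dif_pos w.2]
  · rintro _ ⟨Ξ, hΞ, rfl⟩ w
    exact (𝔇.mem_thetaLocusBL_iff_forall Ξ).1 hΞ w.1

end AdelicLiftDatum

end Summit.ABC.IUTFork.Joshi.ATS3

end
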